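import Literature.MathematicalPhysics.QuantumFieldTheory.Balaban1983to89.B9Thm37GpTorusRegular
import Literature.MathematicalPhysics.QuantumFieldTheory.Balaban1983to89.B9Thm37CommutatorBound389Majorant

/-!
# `Balaban1983to89.B9Thm37GpTorusRegularCubes` — T. Bałaban, *Propagators for lattice gauge theories in a background field*, Commun. Math. Phys.
# **99** (1985) 389–434 [Balaban1985BackgroundPropagators], Theorem 3.7 ⇒ (3.42)₁ for `G′(U)` AT THE CUBE COVER OF RECORD: FILE 1's instantiated
# summation fed with the cover `{□}`, the partition `{h_□}` and the (3.89) commutator majorant of the tree (M5.4), the cube letters' Corollary 3.6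
# entering through their (3.42) blocks over the invariant class (M5.2 dictionary) — M5.5 FILE 3

statement-level skeleton of published theorems with citation tags; proofs where landed; nothing here is a claim about the Yang–Mills mass gap

PDF held: `paper:balaban1985-cmp99-background-propagators` (journal page = PDF page + 388); pp. 397, 408–410 read from the held text layer.

THE PRINT.  p. 408: *«We take the partition of unity {h_□} defined at the end of Sect. A in [4]. We have Σ_{□∈𝒟} h²_□ = 1.»*  p. 409: *«G′₀ = Σ_{□∈𝒟} h_□G′_□h_□ …
(3.87) … Δ′_aG′₀ = I − Σ_{□∈𝒟} K(h_□)G′_□h_□ = I − R′. Using the inequalities (3.42) for G′_□, we get the bound |(K(h_□)G′_□h_□λ)(x)| ≦ O(M⁻¹)e^{−δ₀(Lʲη)⁻¹|y−y′|}|λ|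
(3.89) …»*  p. 410: *«This theorem follows simply from Corollary 3.6 holding for all G′_□, □ ∈ 𝒟, from the bound (3.89) and Lemma 2.1. … Theorem 3.7
implies that all the inequalities (3.42)–(3.47) hold for G′»*.

WHY THIS FILE (cell context: G-B9-LETTERS, module M5.5 FILE 3 — lead g29 allocation 02:13:20Z).  FILE 1 (`B9Thm37GpTorusRegular.hasMajorant_conj_Gp_of_cubes`)
instantiated r06's summation at def-Y's carriers over an ABSTRACT cube index with displayed localized majorants.  THIS FILE fixes the index to the tree's
cube cover `↥(cubes i.D.toDomains)` with p38's partition `hTY i □` (`Σh² = 1`, `|h| ≤ 1`, `supp h_□ ⊂ QT □`: r03∕p21-gen-5's `B6Partition118KLevelTorus*`),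
localisation sets `S_□ = S′_□ = {a : βa ∈ QT □}` with overlap `3·5^{d+1}` (p38's `sum_indicator_QT_le`), and DISCHARGES the two analytic inputs that
the tree already holds: `hT` — from the cube letters' (3.42) blocks over the class `EBlock (kernelFamilySInv … O_□ …) B₀ δ₀ U` (the output shape of
M5.2's `thms31to33_cube_of_reg335` ∘ M5.1b) through `B9CubeLettersInvReadDict.hasMajorant_conj_G_of_eBlockInv` and FILE 1's `hasMajorant_conj_cut_sandwich`;
`h389` — p38's ★ `B9Thm37CommutatorBound389Majorant.hasMajorant_conj_of_bound389` ((3.89) with print's O(M⁻¹) explicit: `θ = M₂(Σ‖b_j‖)·theta389∕((ℓ+1)M_h)`),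
whose (3.42)₁,₂ inputs for `G′_□` are again the class READ lemmas of `B9CubeLettersInvReadDict`.  What stays displayed: the cube letters `O_□` themselves
(r05's M5.1c `GpCubeY`), their blocks `hE` (M5.1b), `G′Δ′_a = 1` (`hinv`, M5.3) and (3.88) (`h388`, p38's `eq388_hT`), the bi-contraction of the bond
variables and transporters at `U` (regular unitary `U`), the five geometric inputs (FILE 1 `geo_inputs_geo9K` above its threshold) and the smallness
«M sufficiently large».  OUTPUT ★★ `e0_kernelFamilySInv_le_of_cubeCover`: the `e 0` entry ((3.42)₁) of def-Y-typed `kernelFamilySInv … G′ …` at `U`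
with EXPLICIT constant and rate `(1−α)δ₀`.

WHAT IS PROVED (all `theorem`s, no `sorry`).  `SQT`∕`mem_SQT` (localisation sets), `hT_of_eBlockInv_cube` (the localized majorant of `η²·h_□O_□(U)h_□`), `hcnt_SQT` (the overlap count in the
`thm37_entry1` shape), ★★ `e0_kernelFamilySInv_le_of_cubeCover`.
-/

noncomputable section

namespace Literature.MathematicalPhysics.QuantumFieldTheory.Balaban1983to89.B9Thm37GpTorusRegularCubes

open Node00 B9CubeLettersInvReadings B9CubeLettersInvReadDict B9Thm37GpTorusRegular
open B9Thm37CubeCoverCommutators (cutMulY hTY KhY)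
open B9Thm37CommutatorBound389 (theta389 theta389_nonneg)
open B9Thm37CommutatorBound389Majorant (hasMajorant_conj_of_bound389 sum_indicator_QT_le)
open B9Thm37CubeCoverCommutatorSizes (side_conditions four_le_P')
open B6Geom246MultiLevelBox (bset blkOf)
open B6Cover236MultiLevelBlocks (cubes)
open B6Partition118KLevelTorusCentral (QT)
open B6Ineq2142KLevelV1 (β)
open B6KLevelCensusIndexV1 (KIdx)
open B6Prop22KLevelCensusEta (epow)
open B6RandomWalk (HasMajorant Triangle254 Ineq261 Ineq263 hasMajorant_mono)
open B9Thm34Ext (toB6)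
open B9FromB6 (EBlock)
open B9GeoNormsKLevelV1 (geo9K geo9K_supNorm_nonneg)
open B9Eq352DivFormLetters (conj)
open scoped Matrix

variable {d ℓ : ℕ} {hd : 1 ≤ d + 1} {hL : Odd (ℓ + 1) ∧ 1 < ℓ + 1} {b₀ b₁ : ℝ}
variable {𝔸 : Type} [NormedRing 𝔸] [NormedAlgebra ℂ 𝔸] [CompleteSpace 𝔸]
variable {ι : Type} [Fintype ι] [DecidableEq ι]
variable (i : KIdx d ℓ hd hL b₀ b₁) (b : Module.Basis ι ℝ 𝔸)
variable [Fintype (geo9K i).Site] [DecidableEq (geo9K i).Site] {Rr : ℝ} {Hp : Prop}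
variable {B : B9.Backgrounds} (cfg : B.Cfg → CfgY 𝔸 i) (parS : SiteParY 𝔸 i) {U₁ : B.Cfg}

/-- the localisation set of a cube in the `thm37_entry1` currency: the carrier indices whose block lies in `QT □` (a definite `Finset`, pinning the
section's `Fintype`∕decidability instances so that every user elaborates the same term). [cite: Balaban1985BackgroundPropagators, (3.91) p.410 (□′ ∩ □ ≠ ∅), dictionary] -/
def SQT (c : ↥(cubes i.D.toDomains)) : Finset (geo9K i).Site :=
  Finset.univ.filter fun a => β i.hN i.D i.hk a ∈ QT i.D (B9GeoLemma21KLevelV1.one_le_Mh i) (four_le_P' i) c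

omit [DecidableEq ι] [DecidableEq (geo9K i).Site] in
/-- membership in the localisation set. [cite: Balaban1985BackgroundPropagators, (3.91) p.410, bookkeeping] -/
theorem mem_SQT (c : ↥(cubes i.D.toDomains)) (a : (geo9K i).Site) :
    a ∈ SQT i c ↔ β i.hN i.D i.hk a ∈ QT i.D (B9GeoLemma21KLevelV1.one_le_Mh i) (four_le_P' i) c := by
  simp only [SQT, Finset.mem_filter, Finset.mem_univ, true_and]

omit [DecidableEq ι] in
/-- **THE OVERLAP COUNT** of the localisation sets in the `thm37_entry1` shape: `Σ_□ 1_{S_□}(a) ≤ 3·5^{d+1}` (p38's `sum_indicator_QT_le`).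
[cite: Balaban1985BackgroundPropagators, (3.91) p.410; Balaban1984PropagatorsII, p.235] -/
theorem hcnt_SQT (a : (geo9K i).Site) : (∑ c : ↥(cubes i.D.toDomains), if a ∈ SQT i c then (1 : ℝ) else 0) ≤ 3 * 5 ^ (d + 1) := by
  have h := sum_indicator_QT_le i a
  refine le_trans (le_of_eq (Finset.sum_congr rfl fun c _ => ?_)) h
  simp only [mem_SQT]

omit [DecidableEq ι] in
/-- ★ **THE `hT` INPUT AT A CUBE OF THE COVER**: the (3.42) block over the class of the cube letter `O_□` at `U₁` (Cor. 3.6 for `G′_□`) gives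
`conj b (η²·h_□O_□(U)h_□)` the localized majorant `1_{S_□}·M₂(Σ‖b_j‖)B₀·ℓ²·e^{−δ₀d}` (`|h_□| ≤ 1`, `supp h_□` only meets blocks of `QT □`).
[cite: Balaban1985BackgroundPropagators, (3.87) p.409, Cor. 3.6 p.408; Balaban1984PropagatorsII, (2.51) p.232] -/
theorem hT_of_eBlockInv_cube (ιB : BlkY i → IBondY i) (hι : ∀ s, β i.hN i.D i.hk (ιB s) = s)
    {M₂ : ℝ} (hM₂ : 0 ≤ M₂) (hrepr : ∀ (v : 𝔸) (j : ι), |b.repr v j| ≤ M₂ * ‖v‖)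
    (O : SiteOpY 𝔸 i) {B₀ δ₀ : ℝ} (hB₀ : 0 ≤ B₀) (hE : EBlock (kernelFamilySInv i B cfg O parS) B₀ δ₀ U₁) (c : ↥(cubes i.D.toDomains)) :
    HasMajorant (g := toB6 (geo9K i) Rr Hp) (fun p : SiteY i × ι => ιB (blkOf i.D.toDomains p.1))
      (conj b ((etaS i ^ 2) • ((cutMulY (𝔸 := 𝔸) (hTY i c)).restrictScalars ℝ * (O (cfg U₁)).restrictScalars ℝ *
        (cutMulY (𝔸 := 𝔸) (hTY i c)).restrictScalars ℝ)))
      (fun a a' => if a ∈ SQT i c then M₂ * (∑ j, ‖b j‖) * B₀ * (geo9K i).len a ^ 2 * Real.exp (-(δ₀ * (geo9K i).dist a a')) else 0) := by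
  obtain ⟨_, hMh2, hR, _⟩ := side_conditions i
  have hO := hasMajorant_conj_G_of_eBlockInv i b cfg O parS (Rr := Rr) (Hp := Hp) hE hB₀ ιB hι hM₂ hrepr rfl
    ((etaS i ^ 2) • (O (cfg U₁)).restrictScalars ℝ) (fun _ => rfl)
  refine hasMajorant_conj_cut_sandwich i b ιB hO (hTY i c) (fun z => ?_) (SQT i c) (fun z hz => ?_)
  · exact B6Partition118KLevelTorus.abs_hT_le_one i.D (B9GeoLemma21KLevelV1.one_le_Mh i) (B9GeoLemma21KLevelV1.one_le_P i) c z
  · refine (mem_SQT i c (ιB (blkOf i.D.toDomains z))).2 ?_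
    rw [hι]
    exact B6Partition118KLevelTorusCentral.blkOf_mem_QT_of_hT_ne_zero hMh2 hR (four_le_P' i) c hz

/-- ★★ **THEOREM 3.7 ⇒ (3.42)₁ FOR `G′(U)` AT THE CUBE COVER OF RECORD**: with the cube letters `O_□` satisfying Cor. 3.6 at `U₁` in the form of their
(3.42) blocks over the class (`hE`), the (3.89) commutator majorant of the tree (p38) for each `K(h_□)O_□h_□`, `G′Δ′_a = 1`, (3.88), the bond variables
and the averaging transporters bi-contractive at `U₁`, [4] Lemma 2.1 at rate `(δ₀, α)` for the member and the smallness
`3·5^{d+1}·θ·c₁(α) < 1` (θ = M₂(Σ‖b_j‖)·theta389∕((ℓ+1)M_h) — «M sufficiently large»), the `e 0` entry of the reading of `G′(U)` over the class obeys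
(3.42)₁ with constant `M₂(Σ‖b_j‖)·N·B₀′c₁(α)(1 − Nθc₁(α))⁻¹`, `N = 3·5^{d+1}`, `B₀′ = M₂(Σ‖b_j‖)B₀`, and rate `(1−α)δ₀`.
[cite: Balaban1985BackgroundPropagators, Thm 3.7 pp.409–410 ⇒ Thm 3.1 (3.42)₁ p.397] -/
theorem e0_kernelFamilySInv_le_of_cubeCover (ιB : BlkY i → IBondY i) (hι : ∀ s, β i.hN i.D i.hk (ιB s) = s)
    {M₂ : ℝ} (hM₂ : 0 ≤ M₂) (hrepr : ∀ (v : 𝔸) (j : ι), |b.repr v j| ≤ M₂ * ‖v‖) (hη : etaS i = |i.cf|⁻¹)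
    (Gp : SiteOpY 𝔸 i) (Oc : ↥(cubes i.D.toDomains) → SiteOpY 𝔸 i) {Δ : Module.End ℝ (SiteY i → 𝔸)}
    (R : ↥(cubes i.D.toDomains) → Module.End ℝ (SiteY i → 𝔸))
    (hR : ∀ c Λ, R c Λ = KhY i parS (hTY i c) (cfg U₁) (Oc c (cfg U₁) (cutMulY (hTY i c) Λ)))
    (hinv : (Gp (cfg U₁)).restrictScalars ℝ * Δ = 1)
    (h388 : Δ * (∑ c, (cutMulY (𝔸 := 𝔸) (hTY i c)).restrictScalars ℝ * (Oc c (cfg U₁)).restrictScalars ℝ *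
      (cutMulY (𝔸 := 𝔸) (hTY i c)).restrictScalars ℝ) = 1 - ∑ c, R c)
    {B₀ δ₀ : ℝ} (hB₀ : 0 ≤ B₀) (hδ₀ : 0 ≤ δ₀) (hE : ∀ c, EBlock (kernelFamilySInv i B cfg (Oc c) parS) B₀ δ₀ U₁)
    (hV : ∀ (μ : Fin (d + 1)) (x : SiteY i), ‖(UboxY i (cfg U₁) μ x : 𝔸)‖ ≤ 1 ∧ ‖(((UboxY i (cfg U₁) μ x)⁻¹ : 𝔸ˣ) : 𝔸)‖ ≤ 1)
    (hTr : ∀ z w : SiteY i, ‖(avgTrY i parS (cfg U₁) z w : 𝔸)‖ ≤ 1 ∧ ‖(((avgTrY i parS (cfg U₁) z w)⁻¹ : 𝔸ˣ) : 𝔸)‖ ≤ 1)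
    (d' : ℕ) {α : ℝ} (hαδ : 0 ≤ (1 - α) * δ₀)
    (htri : Triangle254 (toB6 (geo9K i) Rr Hp)) (hrefl : ∀ y : (geo9K i).Site, (geo9K i).dist y y = 0)
    (hdnn : ∀ y y' : (geo9K i).Site, 0 ≤ (geo9K i).dist y y')
    (h261 : Ineq261 d' (toB6 (geo9K i) Rr Hp) δ₀ α) (h263 : Ineq263 d' (toB6 (geo9K i) Rr Hp) δ₀ α)
    (hsmall : (3 * 5 ^ (d + 1)) * (M₂ * (∑ j, ‖b j‖) * (theta389 d ℓ B₀ δ₀ / (((ℓ : ℝ) + 1) * i.Mh))) * B6.c1 d' δ₀ α < 1)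
    (f : SiteY i → ℝ) (y y' : IBondY i) (hs : (geo9K i).suppIn (Sum.inl f) y') :
    (kernelFamilySInv i B cfg Gp parS).e 0 U₁ (Sum.inl f) y ≤
      M₂ * (∑ j, ‖b j‖) * ((3 * 5 ^ (d + 1)) * (M₂ * (∑ j, ‖b j‖) * B₀) * B6.c1 d' δ₀ α *
        (1 - (3 * 5 ^ (d + 1)) * (M₂ * (∑ j, ‖b j‖) * (theta389 d ℓ B₀ δ₀ / (((ℓ : ℝ) + 1) * i.Mh))) * B6.c1 d' δ₀ α)⁻¹) *
        (geo9K i).len y ^ 2 * Real.exp (-((1 - α) * δ₀ * (geo9K i).dist y y')) * (geo9K i).supNorm (Sum.inl f) := by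
  have hSb : 0 ≤ ∑ j, ‖b j‖ := Finset.sum_nonneg fun _ _ => norm_nonneg _
  have hB₀' : 0 ≤ M₂ * (∑ j, ‖b j‖) * B₀ := mul_nonneg (mul_nonneg hM₂ hSb) hB₀
  have hθ : 0 ≤ M₂ * (∑ j, ‖b j‖) * (theta389 d ℓ B₀ δ₀ / (((ℓ : ℝ) + 1) * i.Mh)) :=
    mul_nonneg (mul_nonneg hM₂ hSb) (div_nonneg (theta389_nonneg d ℓ hB₀ δ₀) (by positivity))
  have hN : (0 : ℝ) ≤ 3 * 5 ^ (d + 1) := by positivity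
  -- (3.89) for every cube, p38's majorant, read from the cube letter's block over the class
  have h389 : ∀ c, HasMajorant (g := toB6 (geo9K i) Rr Hp) (fun p : SiteY i × ι => ιB (blkOf i.D.toDomains p.1)) (conj b (R c))
      (fun a a' => if a ∈ SQT i c then M₂ * (∑ j, ‖b j‖) * (theta389 d ℓ B₀ δ₀ / (((ℓ : ℝ) + 1) * i.Mh)) *
        Real.exp (-(δ₀ * (geo9K i).dist a a')) else 0) := fun c => by
    -- (p38's statement carries the structural decidability of `IBondY i`; `convert` aligns it with the section's instance)
    convert hasMajorant_conj_of_bound389 i b parS c (cfg U₁) (Oc c (cfg U₁)) hB₀ hδ₀ hη ιB hι hV hTr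
      (fun f y y' hs Λ hΛ z hz => sq_eta_mul_norm_le_of_eBlockInv i b cfg (Oc c) parS (hE c) hM₂ hrepr f y y' hs ⟨Λ, hΛ⟩ hz)
      (fun f y y' hs Λ hΛ z μ hz => eta_mul_norm_cdS_le_of_eBlockInv i b cfg (Oc c) parS (hE c) hM₂ hrepr f y y' hs ⟨Λ, hΛ⟩ μ hz)
      hM₂ hrepr (R c) (hR c) (SQT i c) (fun a ha => (mem_SQT i c a).2 ha) using 3
    split_ifs <;> first | rfl | contradiction
  exact e0_kernelFamilySInv_le_of_cubes i b ιB cfg Gp parS hι hM₂ hrepr d' (fun c => SQT i c) (fun c => SQT i c)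
    (fun c => (cutMulY (𝔸 := 𝔸) (hTY i c)).restrictScalars ℝ * (Oc c (cfg U₁)).restrictScalars ℝ * (cutMulY (𝔸 := 𝔸) (hTY i c)).restrictScalars ℝ)
    R hB₀' hθ hN hN hαδ htri hrefl hdnn h261 h263 hsmall
    (fun c => hT_of_eBlockInv_cube i b cfg parS ιB hι hM₂ hrepr (Oc c) hB₀ (hE c) c) (hcnt_SQT i) h389 (hcnt_SQT i) hinv h388 f y y' hs

end Literature.MathematicalPhysics.QuantumFieldTheory.Balaban1983to89.B9Thm37GpTorusRegularCubes

end
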